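/-
Copyright: the b2b-balaban cell (near-miss cell 7), T⁴-continuum fan-out; row NE7b ROUND-2 swarm, seat
t4-ne7b-formalise-leaf-10 (gen 12; row S12n «Θ BUDGET AUDIT» of `t4/b2b-balaban-t4-ne7b-p1/LEAVES-NE7b.md`, owner v3.55,
deliverable (b′); sequel of this lineage's `HistorySiblingMass` (row S6g′(d)) and `HistorySiblingEntropy` (row S6g′(e))).
Released under the licence of the surrounding project.
-/
import Mathlib
import Summits.QuantumFields.BalabanUV.T4Continuum.Support.HistorySiblingEntropy
import Summits.QuantumFields.BalabanUV.T4Continuum.Support.HistoryJoinsSupTorus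

/-!
# History joins, the budget AT A PIVOT: the concave form of the two linearisations behind the count's constant `Θ`
# (row S12n (b′), finding F-leaf10g12-1)

Summits-side support leaf of the T⁴-continuum cell (rung (B)+1 on a FINITE torus only; NOT infinite volume, NOT the
mass gap, NOT the Clay statement; NOT a proof of the spine estimate NE7b).  Row NE7b, route «COUNT», row S12n
«Θ BUDGET AUDIT» (census `HOME/b2b-balaban-t4-ne7b-formalise-leaf-10/g12/CENSUS-THETA-S12n.md`).  [folklore] TREE-FREE
real arithmetic and finite sums; nothing is quoted from print, nothing printed is asserted, no `[cite:]` tag, no `Prop`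
fact minted, no definition; constants symbolic.

WHY (finding F-leaf10g12-1).  The class-linear constant `Θ` of the placement count (`hθJ` of the END of record v3.1′,
`HistoryRealiseCellsRunMultEndPD`, = `HistoryAssemblyMultInstance.card_koccOf_le_exp`'s `hθ`) is `2.36·10²⁷` at
`d = 4`, `L = 13`, collar `32` (census of record C-leaf08g9-1).  Row S12n's audit locates `99.88 %` of it in the radius
product's `(2⌊r⌋₊ + 1)^d ≤ e^{2d·r}` (`HistoryJoinsSupTorus.MρT_le_exp`) and the next `0.12 %` in the budget's
`n·log(Q∕n) ≤ Q − n` (`HistorySiblingMass.group_cost_le` → `HistorySiblingEntropy.classes_cost_le`: `Σ_g (k_g·log Z −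
log k_g!) ≤ 2·Σk + Z + logMultinomial`): two POINTWISE linearisations of logarithms of class-linear quantities.  Both
have a one-parameter CONCAVE form — the tangent line of `log` at a pivot — which is what this file proves; summed with
the SAME class-linear totals the count already displays (`Σ n_J = mrg ≤ F`, `Σ Z_J = MS ≤ κM·F`, `Σ r_i ≤ R·F`), the
pivots `W := κM`, `ρ₀ := R` turn the exponents `(2 + κM)·F` and `2d·R·F` into `(1 + log κM)·F` and
`d·(1 + log(2R+1))·F` (census §3: `Θ_honest ≈ 8.7·10²` at the same letters).

WHAT.
* §1 **`cost_le_pivot`**: `K·log Z − log K! ≤ K·log W + Z∕W` for `0 < Z`, `0 < W`, every `K : ℕ` (`log K! ≥ K log K − K`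
  and `log y ≤ y − 1` at `y := Z∕(K·W)`); at `W := 1` it is `≤ Z`, the tree's rate-zero bound without its `2K`.
* §2 **`classes_cost_le_pivot`**: the classes of one join against one mass — `Σ_g (k_g·log Z − log k_g!) ≤ (Σ_g k_g)·log W
  + Z∕W + logMultinomial Gs k` (the pivot twin of `HistorySiblingEntropy.classes_cost_le`, via `classes_cost_eq`).
* §3 **`sum_cost_le_pivot`** (over any finite family of joins: `≤ (Σ n)·log W + (Σ Z)∕W`) and the class-linear corollary
  **`sum_cost_le_linear`**: `Σ n_i ≤ F`, `Σ Z_i ≤ W·F`, `1 ≤ W` ⇒ `Σ_i (n_i·log Z_i − log n_i!) ≤ (1 + log W)·F`.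
* §4 the distance twin: **`log_MρT_le`** (`log (MρT d r) ≤ d·log(2r+1)`, `0 ≤ r`), **`mul_log_le_pivot`**
  (`d·log(2r+1) ≤ d·log(2ρ₀+1) + d·(2(r − ρ₀)∕(2ρ₀+1))`), **`sum_log_radius_le_linear`**: `#s ≤ F`, `Σ r_i ≤ R·F`, `0 ≤ R`
  ⇒ `Σ_i d·log(2 r_i + 1) ≤ d·(1 + log(2R+1))·F`.
* §5 sanity (decided ∕ `norm_num`).

HONEST SCOPE.  These lemmas are NOT wired into the count: the END of record and its letter `Θ` are unchanged; wiring
them (re-telescoping `HistoryJoinsEntropyBudget.jW_le_budgetE` with `2n + Z ↦ n·log W + Z∕W`, separating the distance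
and size radii of `HistoryJoinsPlaced.nearP`, re-pasting `Θ` through the END ∕ apex files) is the owner's call.  The
socket's shape `θ·birthLinT`, the exits, `HistoryConstants*`, every displayed hypothesis and the headline's Prop are
untouched by this file and would stay untouched by the wiring (only the size of the ∃-bound coupling threshold moves).
NE7b NOT proved; spine 0∕9.  HONEST DEPENDENCY (cell): continuum YM on T⁴ ⇐ BetaPertH ∧ nine spine estimates (0/9
proved); BetaPertH ⇐ (D1) ∧ (D4) ∧ CAP+tail; G-an2-4 gates asym, D1 and NE2/3/4.  This file changes none of it.
-/

open Finset
open Summit.QuantumFields.BalabanUV.T4Continuum.HistorySiblingMass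
open Summit.QuantumFields.BalabanUV.T4Continuum.HistorySiblingEntropy
open Summit.QuantumFields.BalabanUV.T4Continuum.HistoryJoinsSupTorus

namespace Summit.QuantumFields.BalabanUV.T4Continuum.HistoryJoinsBudgetPivot

noncomputable section

/-! ## §1 One mass term at a pivot -/

/-- **ONE CLASS AGAINST A MASS, AT A PIVOT `W`**: `K·log Z − log K! ≤ K·log W + Z∕W` (`0 < Z`, `0 < W`, any `K`). [folklore] -/
theorem cost_le_pivot (K : ℕ) {Z W : ℝ} (hZ : 0 < Z) (hW : 0 < W) :
    (K : ℝ) * Real.log Z - Real.log (K.factorial : ℝ) ≤ (K : ℝ) * Real.log W + Z / W := by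
  rcases Nat.eq_zero_or_pos K with rfl | hK
  · simp only [Nat.cast_zero, zero_mul, Nat.factorial_zero, Nat.cast_one, Real.log_one, sub_zero, zero_add]
    positivity
  · have hK0 : (0 : ℝ) < K := by exact_mod_cast hK
    have hfac := klogk_sub_le_log_factorial K
    set y : ℝ := Z / ((K : ℝ) * W) with hy
    have hy0 : 0 < y := by positivity
    have hlog : Real.log y ≤ y - 1 := Real.log_le_sub_one_of_pos hy0
    have hlogy : Real.log y = Real.log Z - Real.log K - Real.log W := by
      rw [hy, Real.log_div hZ.ne' (by positivity), Real.log_mul hK0.ne' hW.ne']; ring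
    have hKy : (K : ℝ) * y = Z / W := by
      rw [hy]; field_simp
    have hmul : (K : ℝ) * Real.log y ≤ (K : ℝ) * (y - 1) := mul_le_mul_of_nonneg_left hlog hK0.le
    rw [hlogy] at hmul
    nlinarith [hmul, hfac, hKy]

/-- the rate-zero specialisation `W := 1`: `K·log Z − log K! ≤ Z` (the tree's `one_class_cost_le` is `≤ 2K + Z`) [folklore] -/
theorem cost_le_self (K : ℕ) {Z : ℝ} (hZ : 0 < Z) :
    (K : ℝ) * Real.log Z - Real.log (K.factorial : ℝ) ≤ Z := by
  have h := cost_le_pivot K hZ one_pos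
  simp only [Real.log_one, mul_zero, div_one, zero_add] at h
  exact h

/-! ## §2 The classes of one join at a pivot -/

/-- **THE CLASSES OF ONE JOIN, AT A PIVOT**: sizes `k g`, all against one mass `Z > 0`, pivot `W > 0`:
`Σ_g (k_g·log Z − log k_g!) ≤ (Σ_g k_g)·log W + Z∕W + logMultinomial Gs k`. [folklore] -/
theorem classes_cost_le_pivot {β : Type*} (Gs : Finset β) (k : β → ℕ) {Z W : ℝ} (hZ : 0 < Z) (hW : 0 < W) :
    ∑ g ∈ Gs, ((k g : ℝ) * Real.log Z - Real.log ((k g).factorial : ℝ)) ≤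
      ((∑ g ∈ Gs, k g : ℕ) : ℝ) * Real.log W + Z / W + logMultinomial Gs k := by
  rw [classes_cost_eq]
  have h := cost_le_pivot (∑ g ∈ Gs, k g) hZ hW
  linarith

/-! ## §3 Sums over joins: the class-linear form -/

section Sums

variable {ι : Type*}

/-- **THE MASS TERMS OF A FAMILY OF JOINS, AT ONE PIVOT**: `Σ_i (n_i·log Z_i − log n_i!) ≤ (Σ_i n_i)·log W + (Σ_i Z_i)∕W`.
[folklore] -/
theorem sum_cost_le_pivot (s : Finset ι) (n : ι → ℕ) (Z : ι → ℝ) (hZ : ∀ i ∈ s, 0 < Z i) {W : ℝ} (hW : 0 < W) :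
    ∑ i ∈ s, ((n i : ℝ) * Real.log (Z i) - Real.log ((n i).factorial : ℝ)) ≤
      (∑ i ∈ s, (n i : ℝ)) * Real.log W + (∑ i ∈ s, Z i) / W := by
  calc ∑ i ∈ s, ((n i : ℝ) * Real.log (Z i) - Real.log ((n i).factorial : ℝ))
      ≤ ∑ i ∈ s, ((n i : ℝ) * Real.log W + Z i / W) := sum_le_sum fun i hi => cost_le_pivot (n i) (hZ i hi) hW
    _ = (∑ i ∈ s, (n i : ℝ)) * Real.log W + (∑ i ∈ s, Z i) / W := by
        rw [sum_add_distrib, sum_mul, sum_div]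

/-- **THE CLASS-LINEAR FORM**: if the part counts total `≤ F` and the masses total `≤ W·F` with `1 ≤ W`, then
`Σ_i (n_i·log Z_i − log n_i!) ≤ (1 + log W)·F` — the concave replacement of the budget's `(2 + W)·F`. [folklore] -/
theorem sum_cost_le_linear (s : Finset ι) (n : ι → ℕ) (Z : ι → ℝ) (hZ : ∀ i ∈ s, 0 < Z i) {W F : ℝ} (hW : 1 ≤ W)
    (hn : ∑ i ∈ s, (n i : ℝ) ≤ F) (hZF : ∑ i ∈ s, Z i ≤ W * F) :
    ∑ i ∈ s, ((n i : ℝ) * Real.log (Z i) - Real.log ((n i).factorial : ℝ)) ≤ (1 + Real.log W) * F := by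
  have hW0 : 0 < W := lt_of_lt_of_le one_pos hW
  have h := sum_cost_le_pivot s n Z hZ hW0
  have hlogW : 0 ≤ Real.log W := Real.log_nonneg hW
  have h1 : (∑ i ∈ s, (n i : ℝ)) * Real.log W ≤ F * Real.log W := mul_le_mul_of_nonneg_right hn hlogW
  have h2 : (∑ i ∈ s, Z i) / W ≤ F := by
    rw [div_le_iff₀ hW0]; linarith [hZF]
  linarith

/-- the same with the masses' total given against a DIFFERENT constant `M ≥ 1` than the pivot: choosing the pivot
`W := M` is optimal among the class-linear forms `(Σn)·log W + (Σ Z)∕W ≤ (log W + M∕W)·F`. [folklore] -/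
theorem sum_cost_le_of_pivot (s : Finset ι) (n : ι → ℕ) (Z : ι → ℝ) (hZ : ∀ i ∈ s, 0 < Z i) {W M F : ℝ}
    (hW : 1 ≤ W) (hn : ∑ i ∈ s, (n i : ℝ) ≤ F) (hZF : ∑ i ∈ s, Z i ≤ M * F) :
    ∑ i ∈ s, ((n i : ℝ) * Real.log (Z i) - Real.log ((n i).factorial : ℝ)) ≤ (Real.log W + M / W) * F := by
  have hW0 : 0 < W := lt_of_lt_of_le one_pos hW
  have h := sum_cost_le_pivot s n Z hZ hW0
  have hlogW : 0 ≤ Real.log W := Real.log_nonneg hW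
  have h1 : (∑ i ∈ s, (n i : ℝ)) * Real.log W ≤ F * Real.log W := mul_le_mul_of_nonneg_right hn hlogW
  have h2 : (∑ i ∈ s, Z i) / W ≤ M * F / W := div_le_div_of_nonneg_right hZF hW0.le
  calc ∑ i ∈ s, ((n i : ℝ) * Real.log (Z i) - Real.log ((n i).factorial : ℝ))
      ≤ F * Real.log W + M * F / W := by linarith
    _ = (Real.log W + M / W) * F := by ring

end Sums

/-! ## §4 The distance twin: the radius factor kept logarithmic -/

/-- **THE RADIUS FACTOR IS LOGARITHMIC**: `log (MρT d r) ≤ d·log(2r + 1)` for `0 ≤ r` (`2⌊r⌋₊ + 1 ≤ 2r + 1`); the tree's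
`MρT_le_exp` is its linearisation `MρT d r ≤ exp(2d·r)`. [folklore] -/
theorem log_MρT_le (d : ℕ) {r : ℝ} (hr : 0 ≤ r) : Real.log (MρT d r) ≤ (d : ℝ) * Real.log (2 * r + 1) := by
  unfold MρT
  have hfl : ((⌊r⌋₊ : ℕ) : ℝ) ≤ r := Nat.floor_le hr
  have h0 : (0 : ℝ) < 2 * (⌊r⌋₊ : ℕ) + 1 := by positivity
  rw [Real.log_pow]
  exact mul_le_mul_of_nonneg_left (Real.log_le_log h0 (by linarith)) (Nat.cast_nonneg d)

/-- **ONE DISTANCE TERM AT A PIVOT `ρ₀`** (tangent line of `log` at `2ρ₀ + 1`):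
`d·log(2r+1) ≤ d·log(2ρ₀+1) + d·(2(r − ρ₀)∕(2ρ₀+1))` for `0 ≤ r`, `0 ≤ ρ₀`. [folklore] -/
theorem mul_log_le_pivot (d : ℕ) {r ρ₀ : ℝ} (hr : 0 ≤ r) (hρ : 0 ≤ ρ₀) :
    (d : ℝ) * Real.log (2 * r + 1) ≤
      (d : ℝ) * Real.log (2 * ρ₀ + 1) + (d : ℝ) * (2 * (r - ρ₀) / (2 * ρ₀ + 1)) := by
  have h1 : (0 : ℝ) < 2 * r + 1 := by linarith
  have h2 : (0 : ℝ) < 2 * ρ₀ + 1 := by linarith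
  have hlog : Real.log ((2 * r + 1) / (2 * ρ₀ + 1)) ≤ (2 * r + 1) / (2 * ρ₀ + 1) - 1 :=
    Real.log_le_sub_one_of_pos (by positivity)
  rw [Real.log_div h1.ne' h2.ne'] at hlog
  have heq : (2 * r + 1) / (2 * ρ₀ + 1) - 1 = 2 * (r - ρ₀) / (2 * ρ₀ + 1) := by
    field_simp
    ring
  rw [heq] at hlog
  have hd : (0 : ℝ) ≤ d := Nat.cast_nonneg d
  nlinarith [mul_le_mul_of_nonneg_left hlog hd]

/-- **THE DISTANCE TERMS OF A FAMILY OF NON-HOST PARTS, CLASS-LINEAR**: `#s ≤ F`, `Σ_i r_i ≤ R·F`, `0 ≤ R`, `0 ≤ r_i` ⇒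
`Σ_i d·log(2 r_i + 1) ≤ d·(1 + log(2R + 1))·F` (pivot `ρ₀ := R`; `2R∕(2R+1) ≤ 1`). [folklore] -/
theorem sum_log_radius_le_linear {ι : Type*} (s : Finset ι) (r : ι → ℝ) (hr : ∀ i ∈ s, 0 ≤ r i) (d : ℕ) {R F : ℝ}
    (hR : 0 ≤ R) (hcard : (s.card : ℝ) ≤ F) (hsum : ∑ i ∈ s, r i ≤ R * F) :
    ∑ i ∈ s, (d : ℝ) * Real.log (2 * r i + 1) ≤ (d : ℝ) * (1 + Real.log (2 * R + 1)) * F := by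
  have hd : (0 : ℝ) ≤ d := Nat.cast_nonneg d
  have h2R : (0 : ℝ) < 2 * R + 1 := by linarith
  have hlogR : 0 ≤ Real.log (2 * R + 1) := Real.log_nonneg (by linarith)
  have hF : 0 ≤ F := le_trans (Nat.cast_nonneg _) hcard
  -- each term at the pivot `R`, the `−ρ₀` part dropped
  have hterm : ∀ i ∈ s, (d : ℝ) * Real.log (2 * r i + 1) ≤
      (d : ℝ) * Real.log (2 * R + 1) + (d : ℝ) * (2 / (2 * R + 1)) * r i := by
    intro i hi
    have h := mul_log_le_pivot d (hr i hi) hR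
    have hsplit : (d : ℝ) * (2 * (r i - R) / (2 * R + 1)) =
        (d : ℝ) * (2 / (2 * R + 1)) * r i - (d : ℝ) * (2 * R / (2 * R + 1)) := by
      field_simp
    have hnonneg : 0 ≤ (d : ℝ) * (2 * R / (2 * R + 1)) := by positivity
    linarith
  calc ∑ i ∈ s, (d : ℝ) * Real.log (2 * r i + 1)
      ≤ ∑ i ∈ s, ((d : ℝ) * Real.log (2 * R + 1) + (d : ℝ) * (2 / (2 * R + 1)) * r i) := sum_le_sum hterm
    _ = (s.card : ℝ) * ((d : ℝ) * Real.log (2 * R + 1)) + (d : ℝ) * (2 / (2 * R + 1)) * ∑ i ∈ s, r i := by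
        rw [sum_add_distrib, sum_const, nsmul_eq_mul, mul_sum]
    _ ≤ F * ((d : ℝ) * Real.log (2 * R + 1)) + (d : ℝ) * (2 / (2 * R + 1)) * (R * F) := by
        gcongr
    _ = (d : ℝ) * (Real.log (2 * R + 1) + 2 * R / (2 * R + 1)) * F := by
        field_simp
    _ ≤ (d : ℝ) * (1 + Real.log (2 * R + 1)) * F := by
        have hfrac : 2 * R / (2 * R + 1) ≤ 1 := by
          rw [div_le_one h2R]; linarith
        have : (d : ℝ) * (Real.log (2 * R + 1) + 2 * R / (2 * R + 1)) ≤ (d : ℝ) * (1 + Real.log (2 * R + 1)) :=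
          mul_le_mul_of_nonneg_left (by linarith) hd
        exact mul_le_mul_of_nonneg_right this hF

/-! ## §5 Sanity -/

namespace Sanity

/-- the pivot bound beats the rate-zero tree bound as soon as `Z` exceeds the pivot: at `K = 1`, `Z = W`:
`log W − 0 ≤ log W + 1`. [folklore] -/
example {W : ℝ} (hW : 0 < W) : (1 : ℕ) * Real.log W - Real.log ((1 : ℕ).factorial : ℝ) ≤ (1 : ℕ) * Real.log W + W / W :=
  cost_le_pivot 1 hW hW

/-- the class-linear form on a two-join toy: parts `1, 2`, masses `4, 8`, `F = 3`, `W = 4` (`4 + 8 ≤ 4·3`):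
`(1·log 4 − log 1!) + (2·log 8 − log 2!) ≤ (1 + log 4)·3`. [folklore] -/
example : ∑ i : Fin 2, (((![1, 2] : Fin 2 → ℕ) i : ℝ) * Real.log ((![4, 8] : Fin 2 → ℝ) i) -
    Real.log ((((![1, 2] : Fin 2 → ℕ) i)).factorial : ℝ)) ≤ (1 + Real.log 4) * 3 := by
  refine sum_cost_le_linear (univ : Finset (Fin 2)) (![1, 2]) (![4, 8]) ?_ (by norm_num) ?_ ?_
  · intro i _
    fin_cases i <;> simp
  · simp [Fin.sum_univ_two]; norm_num
  · simp [Fin.sum_univ_two]; norm_num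

/-- the distance form on one part at distance `R`: `d·log(2R+1) ≤ d·(1 + log(2R+1))·1`. [folklore] -/
example (d : ℕ) {R : ℝ} (hR : 0 ≤ R) :
    ∑ i ∈ ({0} : Finset ℕ), (d : ℝ) * Real.log (2 * (fun _ => R) i + 1) ≤ (d : ℝ) * (1 + Real.log (2 * R + 1)) * 1 :=
  sum_log_radius_le_linear {0} (fun _ => R) (fun _ _ => hR) d hR (by simp) (by simp)

end Sanity

end

end Summit.QuantumFields.BalabanUV.T4Continuum.HistoryJoinsBudgetPivot
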